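import Summits.BirchSwinnertonDyer.BirchSwinnertonDyer.Theorems.BiquadraticEisensteinDescentHeegnerTwistCouplingInSupplySylvesterTwistPhiHatSha
import Summits.BirchSwinnertonDyer.BirchSwinnertonDyer.Theorems.BiquadraticEisensteinDescentHeegnerTwistCouplingInSupplySylvesterTwistPhiBox
import Literature.NumberTheory.QuadraticFields.SqrtNegTwoRingOfIntegers
import HarnessLib

set_option linter.dupNamespace false -- `Summit.BirchSwinnertonDyer.BirchSwinnertonDyer.Theorems.…` (summit = sub, D-0017)
set_option autoImplicit false

/-!
# Crux `HeegnerTwistCouplingInSupply` (stmt-BirchSwinnertonDyer-21381) — programme «TWISTED 3-ISOGENY DESCENT», file P7b: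
# `Ш(E/ℚ) ∩ ker φ_* = 0` for the Sylvester twist `E : y² = x³ − 2p²` under the certificate (h1)
# «some unit of `𝓞_{ℚ(√6)}` is not a cube modulo `p`», `p ≡ 8 (mod 9)`, `p = a² + 2b²`

Route `BiquadraticEisensteinDescent` (cell `pub/bsd-wall`, width seat `bsd-wall-cm-bed-w4` g33; `--supports` 21381, helper). The `φ`-HALF
of the descent, assembled over `ℚ` (mirror of file P7a for `φ̂`): the kernel `{O, (0, ±p√−2)}` of `φ : E → E' = mordellCurve(54p²)` is
`ℤ/3` TWISTED by `χ_{−2}`; its Kummer field is `L = ℚ(√(−3·(−2p²))) = ℚ(√6) = F` (REAL), over which the kernel is `μ₃` and the Mordell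
datum `E_F = mordellCurve(−3c″²)`, `c″ = pω/3` (`ω² = 6`) applies. The generic twisted-kernel theorem
`Literature…TwistedKummer.eq_zero_of_mem_sha_of_galH1Map_eq_zero_mordell` (P3c) reduces `Ш(E/ℚ) ∩ ker φ_* = 0` to the SHARP norm-cube
box over `F`, which is file P5c (`torsorClass_eq_zero_of_mem_sha_of_norm_cube_phi`, certificate (h1)).

* §1 inputs on a model `F ∋ ω`, `ω² = 6`, of `ℚ(√6)`: `omega_not_mem_range` (`ω ∉ ℚ`), `sq_ne_neg_three_of_discr_pos` (`√−3 ∉ F`, `F` is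
  real), `algEquiv_apply_apply_of_finrank_eq_two` (`c ∘ c = 1`), `algEquiv_omega` (`c ω = −ω` for `c ≠ 1`);
* §2 ★★ `eq_zero_of_mem_sha_of_galH1Map_phi_eq_zero` — for ANY model `F ∋ ω` of `ℚ(√6)` with non-trivial automorphism `c`, a prime
  `p ≡ 8 (mod 9)`, `p = a² + 2b²`, the certificate (h1) `∃ u₀ ∈ 𝓞_Fˣ, ∀ x, u₀ − x³ ∉ (p)`, ANY Vélu pair `hV` with parameters `(0, s)`
  on `E = mordellCurve(−2p²)` over `ℚ̄` and any equivariant `f = hV.pointFun`: every `c₀ ∈ Ш(E/ℚ)` with `f_* c₀ = 0` is `0`.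

HONEST FRAMING: the second half (`φ`) of a `3`-isogeny descent for ONE CM family under the decidable certificate (h1) (the first half,
`φ̂` under (h2), is P7a); the assembly `rank = 0 ∧ Ш[3] = 0` (P7c), `hDescU`, the crux (residual C⁺) and BSD are untouched. THEOREMS ONLY
(no `def`, no named fact, no sorry). Supports stmt-BirchSwinnertonDyer-21381.
[cite: CohenPazuki2009, Proposition 2.2 and §4] [cite: SilvermanAEC2009, Thm. X.4.2 (a), Remark III.4.13.2] [cite: Marcus2018, Ch. 2 Thm. 1]
-/

noncomputable section

open scoped Classical

namespace Summit.BirchSwinnertonDyer.BirchSwinnertonDyer.Theorems.SylvesterTwistDescent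

open Literature.NumberTheory.EllipticCurves Literature.NumberTheory.EllipticCurves.MordellDescent
open Literature.NumberTheory.EllipticCurves.TwistedKummer Literature.NumberTheory.QuadraticFields
open Literature.NumberTheory.GaloisRepresentations NumberField
open WeierstrassCurve

/-! ## §1 Inputs on a model of `ℚ(√6)` -/

section Inputs

variable {F : Type} [Field F] [NumberField F] (hF2 : Module.finrank ℚ F = 2) {ω : F} (hω : ω ^ 2 = 6)

include hω in
/-- **`ω ∉ ℚ`** (`(2ω)² = 24` is a fundamental discriminant, hence not a rational square). [cite: Marcus2018, Ch. 2 Thm. 1] -/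
theorem omega_not_mem_range : ω ∉ Set.range (algebraMap ℚ F) := by
  have hsf : Squarefree (6 : ℤ) := by
    rw [← Int.squarefree_natAbs, show Int.natAbs 6 = 2 * 3 by norm_num, Nat.squarefree_mul (by norm_num)]
    exact ⟨Nat.prime_two.prime.squarefree, Nat.prime_three.prime.squarefree⟩
  have h2ω : (2 * ω) ∉ Set.range (algebraMap ℚ F) :=
    Quadratic.not_mem_range_of_sq_eq_of_isFundamental (D := 24) (by rw [mul_pow, hω, map_intCast]; norm_num)
      (Or.inr ⟨by norm_num, Or.inl (by norm_num), by norm_num; exact hsf⟩)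
  rintro ⟨r, hr⟩
  exact h2ω ⟨2 * r, by rw [map_mul, hr, map_ofNat]⟩

include hF2 in
/-- **`√−3 ∉ F`** for a quadratic field of positive discriminant (`F` has a real embedding). [cite: Marcus2018, Ch. 2 Thm. 1] -/
theorem sq_ne_neg_three_of_discr_pos (hd : 0 < NumberField.discr F) (q : F) : q ^ 2 ≠ -3 := by
  obtain ⟨σ⟩ := Quadratic.exists_ringHom_real hF2 hd
  intro h
  have h' := congrArg σ h
  rw [map_pow, map_neg, map_ofNat] at h'
  nlinarith [sq_nonneg (σ q)]

include hF2 in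
/-- `c (c x) = x` for a `ℚ`-automorphism of the quadratic field `F`. [cite: Marcus2018, Ch. 2 (the conjugation `√m ↦ −√m`)] -/
theorem algEquiv_apply_apply_of_finrank_eq_two (c : F ≃ₐ[ℚ] F) (x : F) : c (c x) = x := by
  have hcard : Fintype.card (F ≃ₐ[ℚ] F) ≤ 2 := hF2 ▸ AlgEquiv.card_le
  have hdvd : orderOf c ∣ Fintype.card (F ≃ₐ[ℚ] F) := orderOf_dvd_card
  have hle : orderOf c ≤ 2 := (Nat.le_of_dvd Fintype.card_pos hdvd).trans hcard
  have hpos : 0 < orderOf c := orderOf_pos c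
  have h2 : c ^ 2 = 1 := by
    interval_cases h : orderOf c
    · rw [orderOf_eq_one_iff.mp h, one_pow]
    · rw [← h, pow_orderOf_eq_one]
  have := congrArg (fun σ : F ≃ₐ[ℚ] F => σ x) h2
  simpa [sq, AlgEquiv.mul_apply] using this

include hF2 hω in
/-- **`c ω = −ω`** for the non-trivial automorphism `c` (`(cω)² = 6`; `cω = ω` would make `c` fix `F = ℚ ⊕ ℚω`).
[cite: Marcus2018, Ch. 2 (the conjugation `√m ↦ −√m`)] -/
theorem algEquiv_omega {c : F ≃ₐ[ℚ] F} (hc : c ≠ 1) : c ω = -ω := by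
  have hsq' : (c ω - ω) * (c ω + ω) = 0 := by
    have : c ω ^ 2 = ω ^ 2 := by rw [← map_pow, hω, map_ofNat]
    linear_combination this
  rcases mul_eq_zero.mp hsq' with h | h
  · exfalso
    apply hc
    rw [sub_eq_zero] at h
    apply AlgEquiv.ext
    intro y
    obtain ⟨r, s, rfl⟩ := Quadratic.exists_eq_add_mul hF2 (omega_not_mem_range hω) y
    rw [map_add, map_mul, AlgEquiv.commutes, AlgEquiv.commutes, h, AlgEquiv.one_apply]
  · exact eq_neg_of_add_eq_zero_left h

end Inputs

/-! ## §2 `Ш(E/ℚ) ∩ ker φ_* = 0` under (h1) -/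

section Phi

variable {F : Type} [Field F] [NumberField F] (hF2 : Module.finrank ℚ F = 2) {ω : F} (hω : ω ^ 2 = 6) (c : F ≃ₐ[ℚ] F)
  (hc : c ≠ 1) {p : ℕ} (hp : p.Prime) (hp9 : p % 9 = 8) {a b : ℤ} (hab : a ^ 2 + 2 * b ^ 2 = p)

include hF2 hω hc hp hp9 hab in
/-- ★★ **`Ш(E/ℚ) ∩ ker φ_* = 0` for the Sylvester twist `E : y² = x³ − 2p²` under (h1).** Let `F ∋ ω`, `ω² = 6` be a model of
`ℚ(√6)` with non-trivial automorphism `c`, `p ≡ 8 (mod 9)` a prime, `p = a² + 2b²`, and assume the certificate (h1): some unit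
`u₀ ∈ 𝓞_Fˣ` is not a cube modulo `(p)`. For every Vélu pair `hV` with parameters `(0, s)` on `E = mordellCurve(−2p²)` /
`E' = mordellCurve(−27·(−2p²))` over `ℚ̄` (`TwistedKummer.isVeluThreePair_of_sq_eq`) and every `Γ_ℚ`-equivariant `f` agreeing with
`hV.pointFun` (`TwistedKummer.exists_hom_of_sq_eq`): every `c₀ ∈ Ш(E/ℚ)` with `f_* c₀ = 0` vanishes. Proof: P3c's
`eq_zero_of_mem_sha_of_galH1Map_eq_zero_mordell` with Kummer field `L = F` (`−3·(−2p²) = 6p²`), the Mordell datum `c″ = pω/3` on `E_F`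
and the sharp box P5c. [cite: CohenPazuki2009, Proposition 2.2 and §4] [cite: SilvermanAEC2009, Thm. X.4.2 (a)] -/
theorem eq_zero_of_mem_sha_of_galH1Map_phi_eq_zero
    (h1 : ∃ u₀ : (𝓞 F)ˣ, ∀ x : 𝓞 F, (u₀ : 𝓞 F) - x ^ 3 ∉ Ideal.span {(p : 𝓞 F)}) {s : AlgebraicClosure ℚ}
    (hV : IsVeluThreePair (0 : AlgebraicClosure ℚ) s ((mordellCurve (-2 * (p : ℚ) ^ 2)).baseChange (AlgebraicClosure ℚ))
      ((mordellCurve (-27 * (-2 * (p : ℚ) ^ 2))).baseChange (AlgebraicClosure ℚ)))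
    (f : geomPoints (mordellCurve (-2 * (p : ℚ) ^ 2)) →+ geomPoints (mordellCurve (-27 * (-2 * (p : ℚ) ^ 2))))
    (hf : ∀ (σ : Field.absoluteGaloisGroup ℚ) (P : geomPoints (mordellCurve (-2 * (p : ℚ) ^ 2))), f (σ • P) = σ • f P)
    (hfV : ∀ P, f P = hV.pointFun P)
    {c₀ : (mordellCurve (-2 * (p : ℚ) ^ 2)).galH1} (hc₀ : c₀ ∈ (mordellCurve (-2 * (p : ℚ) ^ 2)).sha) (h0 : galH1Map f hf c₀ = 0) :
    c₀ = 0 := by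
  have hcω : c ω = -ω := algEquiv_omega hF2 hω hc
  haveI : Algebra.IsQuadraticExtension ℚ F := { finrank_eq_two' := hF2 }
  haveI : IsGalois ℚ F := inferInstance
  -- the data over `ℚ`
  have hp0 : (p : ℚ) ≠ 0 := Nat.cast_ne_zero.mpr hp.ne_zero
  have hk0 : (-2 * (p : ℚ) ^ 2) ≠ 0 := mul_ne_zero (by norm_num) (pow_ne_zero 2 hp0)
  -- the Kummer field `L = F`: real, involution, lift negating `√−3`, degree
  have hd24 := discr_eq_twentyFour hF2 hω
  have hL : ∀ q : F, q ^ 2 ≠ -3 := sq_ne_neg_three_of_discr_pos hF2 (by rw [hd24]; norm_num)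
  have hc2 : ∀ x : F, (c : F ≃+* F) ((c : F ≃+* F) x) = x := fun x => algEquiv_apply_apply_of_finrank_eq_two hF2 c x
  obtain ⟨cbar, hcbar, hcbθ⟩ := exists_lift_neg_theta' hL (c : F ≃+* F)
  have hdeg : Nat.Coprime 3 (Module.finrank ℚ F) := by rw [hF2]; decide
  -- the Mordell datum on `E_F`: `−2p² = −3·(pω/3)²`
  have hω0 : ω ≠ 0 := fun h => by rw [h] at hω; norm_num at hω
  have hc' : (p * ω / 3 : F) ≠ 0 := div_ne_zero (mul_ne_zero (Nat.cast_ne_zero.mpr hp.ne_zero) hω0) three_ne_zero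
  have hD : algebraMap ℚ F (-2 * (p : ℚ) ^ 2) = -3 * (p * ω / 3) ^ 2 := by
    rw [map_mul, map_pow, map_natCast, map_neg, map_ofNat]; linear_combination ((p : F) ^ 2 / 3) * hω
  obtain ⟨𝒯, h₀, hT𝒯, hbox𝒯⟩ := exists_muThreeKernel_of_eq hc' hD (mordellCurve_baseChange (-2 * (p : ℚ) ^ 2) F)
  -- the kernel point is `c̄`-fixed: `c̄((pω/3)·√−3) = (−pω/3)(−√−3)`
  have hy : cbar (sCoord (p * ω / 3 : F)) = sCoord (p * ω / 3 : F) := by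
    have hcc : (c : F ≃+* F) (p * ω / 3) = -(p * ω / 3) := by
      change c (p * ω / 3) = -(p * ω / 3)
      rw [map_div₀, map_mul, map_natCast, map_ofNat, hcω]; ring
    rw [sCoord, map_mul, hcbar, hcbθ, hcc, map_neg]; ring
  -- the transported point `T = (0, s₁)`, `s₁² = −2p² = s²`
  obtain ⟨T, hT⟩ := exists_geomPoint_transport 𝒯
  obtain ⟨s₁, hs₁0, hTs₁, -⟩ := exists_transport_eq_some_zero hT hT𝒯
  have hs₁ : s₁ ^ 2 = algebraMap ℚ (AlgebraicClosure ℚ) (-2 * (p : ℚ) ^ 2) := sq_eq_of_nonsingular_zero hs₁0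
  have hs : s ^ 2 = algebraMap ℚ (AlgebraicClosure ℚ) (-2 * (p : ℚ) ^ 2) := sq_eq_of_nonsingular_zero hV.nonsingular_T
  have hV₁ := isVeluThreePair_of_sq_eq hk0 hs₁
  have hfV₁ : ∀ P, f P = hV₁.pointFun P := fun P => (hfV P).trans (pointFun_eq_of_sq_eq hV hV₁ (by rw [hs, hs₁]) P)
  -- the sharp box over `F` (P5c)
  have hbox : ∀ {u : F} (hu : u ≠ 0), (∃ r : F, (c : F ≃+* F) r = r ∧ r ≠ 0 ∧ u * (c : F ≃+* F) u = r ^ 3) →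
      𝒯.torsorClass hu ∈ ((mordellCurve (-2 * (p : ℚ) ^ 2)).baseChange F).sha → 𝒯.torsorClass hu = 0 := by
    intro u hu hn
    have hn' : ∃ r : F, c r = r ∧ r ≠ 0 ∧ u * c u = r ^ 3 := hn
    exact hbox𝒯 hu (fun hs' => torsorClass_eq_zero_of_mem_sha_of_norm_cube_phi hF2 hω c hp hp9 hab h1 hc' hD hu hn' hs')
  exact eq_zero_of_mem_sha_of_galH1Map_eq_zero_mordell (c : F ≃+* F) hc2 cbar hcbar hcbθ hL hdeg 𝒯 hT𝒯 hy hT hTs₁ hV₁ f hf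
    hfV₁ hbox hc₀ h0

end Phi

end Summit.BirchSwinnertonDyer.BirchSwinnertonDyer.Theorems.SylvesterTwistDescent

end
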